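import Summits.AtomisticToContinuum.Crystallization.Theorems.OverbindingBudgetAffineBarlowSum
import Summits.AtomisticToContinuum.Crystallization.Theorems.OverbindingBudgetAffineDefectPairFloor

/-!
# OverbindingBudget — the FAR smooth split: continuation infimum of the reference tail, Z3‴ on the SHELTERED class, and the PROVED seam (v7)
# (decomp-a2c lens-4, generation 48; critic row 775 «crossing intrinsic faults» (R7–R9, canonical form R7′) on top of v6 = review q15673607 + critic row 762 R1–R6)

Sequel of `…OverbindingBudgetAffineFarSmoothSplit` v7 (vocabulary, the SHELTER `Sheltered` / `shelteredFarSet` with the PROVED packing count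
`card_far_not_sheltered_le`, Z2 `FarCoreExcess`, Zr‴ `ShelteredCoreRegistration`, Z4″ `ScaleBadFloor`; reference structures = Literature
`barlowStacking 1 √(2/3) c.s`); imports `…BarlowSum` (for `one_le_norm_of_mem_barlowStacking` and the uniform majorant
`neg_tsum_ljMajorant_le_tsum_weighted`) and the tree's `…AffineDefectPairFloor` (for the off-class row floor `sum_compl_lennardJones_ge`, which floors
the UNSHELTERED normal far rows).  0 sorry; record corollary at the slot-Z literals `(12, 1/25, 1/2000, 1/(2·10⁷))` of the PARAMETRIC cone.
§1–§2 (byte-identical to generations 46/47): `Continues θ c c'` = `c'` is admissible with the SAME linear part, scale and nearest distance and the SAME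
structure points in the open CORE ball `a₀‖B p‖ < (44/5)·nn`; `tailInf θ c := inf {refTail c' | c' continues c}` — a GENUINE infimum
(`bddBelow_refTail_continues`, `tailInf_le_refTail_of_continues`, `θ ≤ 1/18`); continuation is an equivalence on admissible charts
(`continues_iff_of_continues`, `tailInf_eq_of_continues`); the reference smooth CORE `refEnergy − refTail` and `PatternFar` are continuation-invariant
(`core_eq_of_continues`, `patternFar_of_continues`, `θ ≤ 1/5`).
§3 Z3‴ (v7): `ShelteredTailTransferInf θ θ₀` := R_aff ⇒ `∀ C ≥ 0 ∀ R ≥ 0 ∃ C', ε_B ∀ ε₁ ≤ ε_B ∀ δ ∈ (0,2] ∃ C_T ≥ 0 ∀ N y F` (admissible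
`Cε₁`-exact
charts on the SHELTERED normal far class `Sh_R = shelteredFarSet R θ₀ 12 ε₁ θ δ y` only): `Σ_{i∈Sh_R} (tailInf θ (F i) − smoothTail G y i) ≤ C_T·#Gᶜ +
C'·ε₁·#Sh_R`, and its SELECTION form `ShelteredTailTransferSel` (`∃ F'` continuing `F` sitewise on `Sh_R`, `refTail (F' i)` in place of `tailInf`), with
`shelteredTailTransferSel_of_inf` (`C' ↦ C' + 1`).  CHANGE vs v6's Z3″: hypothesis and sum range over `Sh_R` instead of `Fn = Far ∖ sb`, for EVERY shelter
radius `R` (it is Zr‴'s, unknown to Z3‴'s prover); `R = 0` is Z3″ verbatim (`Sh_0 = Fn` for an injective configuration).  Everything else — no sb-indexed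
term, `∃ C_T` AFTER `δ`, explicit R_aff — as ruled in rows 762/775 (Q1 of record = YES).  The bound is a SITEWISE excess-mass statement up to the shadows
of non-good sites (each row is controlled by its own chart, R_aff applied afresh to the other good balls, and the wall accounting), so restricting the
class loses nothing; the matter of unsheltered or uncharted good sites still enters every sheltered row's `smoothTail G`.
WHY TRUE (regimes (a)–(f) of the Split's module doc): coherent drift `O(ε₁)` per site — `C'ε₁`; incoherent denser good grains are walled (`≥ 17·S/a² +
18·S` non-good skin against `≤ 3.7·10⁻⁴·S/a³` inflicted: `C_T ≍ 2.2·10⁻⁵/δ`, films attain it); wall-free funnels terminate in walls; irregular matter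
inflicts nothing; a SECOND h-plane family beyond the chart ball shifts a row by a Poisson-summation remainder `≤ e^{−(4π/√3)·d/nn}` and, together with the
row's own family, forces a crossing/termination defect within `≈ (D + 9)/sin(α/2)` whose `δ`-discrete shadow pays (`C_T(δ)`).  Might fail: a wall-free,
regular, denser good region whose density contrast within distance `r` of a sheltered site beats `exp(cε₁·r/nn)` — the globalised frame-coherence lemma
«regular and wall-free over distance `r` ⇒ one smoothly deformed lattice with `|∇F|·nn ≤ cε₁`» is unproved (unchanged from v6).
§4 SEAM (PROVED): `FarCoreExcess θ θ₀ κ → ShelteredCoreRegistration θ θ₀ → ShelteredTailTransferSel θ θ₀ → ScaleBadFloor θ κ → θ ≤ 1/5 →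
FarAggregatePricing 12 θ θ₀ κ`.  Rows of `Far = Sh_R ∪ Un ∪ sb` (`Un := (Far ∖ sb) ∖ Sh_R`): sheltered rows as in v6 (Zr‴'s chart `c`, the selected
continuation `c'`: row `≥ e⋆ + κ + m − C₂ε₁ − (refTail c' − smoothTail)` by core invariance and Z2 at `c'`; summed, Z3‴, `(C₂ + C')ε₁ ≤ m`); UNSHELTERED
rows floored at `−1024/(12δ⁶)` each (`half_pairSum_ge_of_subset_goodSet`: `G` is `δ`-separated) and counted by the Split's packing lemma `#Un ≤ (4R/δ + 1)³·#Gᶜ`;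
scale-bad rows by Z4″.  Constants per `(ε₁, δ)`: `c := p`, `C := C_T + C₄ + (4R/δ + 1)³·(1024/(12δ⁶) + |e⋆ + κ|)`; `ε₀ := min(ε_A, ε_B, ε_C,
m/(C₂ + C' + 1))`.
Also the `…Inf` version and the record corollary at `(1/25, 1/2000, 1/(2·10⁷))`.
-/

namespace Summit.AtomisticToContinuum.Crystallization.Theorems.OverbindingBudgetAffineFarSmoothSplit

open scoped BigOperators Classical
open Literature.MathematicalPhysics.StatisticalMechanics
open Literature.Geometry.DiscreteGeometry (nearestDist nearestDist_nonneg fccTwoShellPattern hcpTwoShellPattern)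
open Summit.AtomisticToContinuum.Crystallization.Theorems.OverbindingBudgetBalancedCensusStatements
open Summit.AtomisticToContinuum.Crystallization.Theorems.OverbindingBudgetAffineLadder
open Summit.AtomisticToContinuum.Crystallization.Theorems.OverbindingBudgetAffineLocalisation

variable {N : ℕ}

local notation "E3" => EuclideanSpace ℝ (Fin 3)

/-! ## §1  Continuations of a chart and the continuation infimum of the reference tail -/

/-- `Continues θ c c'`: `c'` is an admissible chart with the same linear part, scale and nearest distance as `c`, whose reference structure
has the SAME points as `c`'s in the open core ball `a₀‖B p‖ < (44/5)·nn` (the support of `1 − tailW`). -/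
def Continues (θ : ℝ) (c c' : Chart) : Prop :=
  ChartAdmissible θ c' ∧ c'.B = c.B ∧ c'.a₀ = c.a₀ ∧ c'.nn = c.nn ∧
    ∀ p : E3, c.a₀ * ‖c.B p‖ < 44 / 5 * c.nn → (p ∈ barlowStacking 1 (Real.sqrt (2 / 3)) c.s ↔ p ∈ barlowStacking 1 (Real.sqrt (2 / 3)) c'.s)

/-- The CONTINUATION INFIMUM of the reference tail: `inf {refTail c' | c' continues c}`. -/
noncomputable def tailInf (θ : ℝ) (c : Chart) : ℝ := sInf (refTail '' {c' | Continues θ c c'})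

/-- An admissible chart continues itself. [this file] -/
theorem continues_refl {θ : ℝ} {c : Chart} (hc : ChartAdmissible θ c) : Continues θ c c :=
  ⟨hc, rfl, rfl, rfl, fun _ _ => Iff.rfl⟩

/-- Continuation classes of continuing charts coincide. [this file] -/
theorem continues_iff_of_continues {θ : ℝ} {c c' : Chart} (h : Continues θ c c') {d : Chart} :
    Continues θ c d ↔ Continues θ c' d := by
  obtain ⟨-, hB, ha, hn, hball⟩ := h
  constructor
  · rintro ⟨hd, hB', ha', hn', hball'⟩
    refine ⟨hd, hB'.trans hB.symm, ha'.trans ha.symm, hn'.trans hn.symm, fun p hp => ?_⟩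
    rw [hB, ha, hn] at hp
    exact (hball p hp).symm.trans (hball' p hp)
  · rintro ⟨hd, hB', ha', hn', hball'⟩
    refine ⟨hd, hB'.trans hB, ha'.trans ha, hn'.trans hn, fun p hp => ?_⟩
    have hp' : c'.a₀ * ‖c'.B p‖ < 44 / 5 * c'.nn := by rw [hB, ha, hn]; exact hp
    exact (hball p hp).trans (hball' p hp')

/-- **POSITIVE PROBE (kills the review witness): continuing charts have the same continuation infimum.** [this file] -/
theorem tailInf_eq_of_continues {θ : ℝ} {c c' : Chart} (h : Continues θ c c') : tailInf θ c' = tailInf θ c := by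
  unfold tailInf; congr 1; ext x
  simp only [Set.mem_image, Set.mem_setOf_eq, continues_iff_of_continues h]

/-- ε-minimisers of the continuation infimum (the class is nonempty: `c` itself). [this file] -/
theorem exists_continues_lt {θ : ℝ} {c : Chart} (hc : ChartAdmissible θ c) {ξ : ℝ} (hξ : 0 < ξ) :
    ∃ c' : Chart, Continues θ c c' ∧ refTail c' < tailInf θ c + ξ := by
  have hne : (refTail '' {c' | Continues θ c c'}).Nonempty := ⟨refTail c, c, continues_refl hc, rfl⟩
  obtain ⟨x, ⟨c', hc', rfl⟩, hlt⟩ := exists_lt_of_csInf_lt hne (lt_add_of_pos_right (tailInf θ c) hξ)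
  exact ⟨c', hc', hlt⟩

/-! ## §2  Continuation invariance of the reference smooth core and of `PatternFar` -/

/-- **`refTail` is bounded below, uniformly on the admissibility class with fixed scale** (`θ ≤ 1/18`, i.e. `3θ ≤ 1/6`): by `−½ ∑ ljMajorant a₀ (3θ)`
(BarlowSum′), a bound independent of the Hägg sequence and of the linear part. [this file] -/
theorem neg_majorant_le_refTail {θ : ℝ} (hθ : θ ≤ 1 / 18) {c : Chart} (hc : ChartAdmissible θ c) :
    -(1 / 2 * ∑' t : ℤ × ℤ × ℤ, ljMajorant c.a₀ (3 * θ) t) ≤ refTail c := by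
  have h := neg_tsum_ljMajorant_le_tsum_weighted hc.1 (by linarith : 3 * θ ≤ 1 / 6) hc.2.2.2.1 hc.2.1
    (w := fun p : E3 => tailW c.nn (c.a₀ * ‖c.B p‖)) (fun p => tailW_nonneg _ _) (fun p => tailW_le_one _ _)
  unfold refTail
  linarith

/-- **`refTail` is bounded below on every continuation class** — so `tailInf θ c = sInf (refTail '' {c' | Continues θ c c'})` is a GENUINE infimum for an
admissible `c` (`θ ≤ 1/18`; record `θ = 1/25`), not the junk value of `Real.sInf` on an unbounded set (interface non-junk; the Z3′ prover's first step;
critic row 746 (E)). [this file] -/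
theorem bddBelow_refTail_continues {θ : ℝ} (hθ : θ ≤ 1 / 18) (c : Chart) :
    BddBelow (refTail '' {c' | Continues θ c c'}) := by
  refine ⟨-(1 / 2 * ∑' t : ℤ × ℤ × ℤ, ljMajorant c.a₀ (3 * θ) t), ?_⟩
  rintro _ ⟨c', hc', rfl⟩
  have h := neg_majorant_le_refTail hθ hc'.1
  rw [hc'.2.2.1] at h
  exact h

/-- `tailInf θ c ≤ refTail c'` for every continuation `c'` of `c` (`θ ≤ 1/18`). [this file] -/
theorem tailInf_le_refTail_of_continues {θ : ℝ} (hθ : θ ≤ 1 / 18) {c c' : Chart} (h : Continues θ c c') :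
    tailInf θ c ≤ refTail c' :=
  csInf_le (bddBelow_refTail_continues hθ c) ⟨c', h, rfl⟩

/-- In particular `tailInf θ c ≤ refTail c` for an admissible chart (`θ ≤ 1/18`). [this file] -/
theorem tailInf_le_refTail {θ : ℝ} (hθ : θ ≤ 1 / 18) {c : Chart} (hc : ChartAdmissible θ c) : tailInf θ c ≤ refTail c :=
  tailInf_le_refTail_of_continues hθ (continues_refl hc)

/-- `tailW = 1` beyond `8.8·nn`. [this file] -/
theorem tailW_eq_one {nn ρ : ℝ} (hnn : 0 < nn) (h : 44 / 5 * nn ≤ ρ) : tailW nn ρ = 1 := by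
  have ht : 1 ≤ (ρ / nn - 9 / 2) / (43 / 10) := by
    rw [le_div_iff₀ (by norm_num : (0 : ℝ) < 43 / 10), le_sub_iff_add_le, le_div_iff₀ hnn]; linarith
  unfold tailW sigma15
  rw [if_neg (not_le.mpr (by linarith)), if_pos ht]

/-- The summand of the reference smooth core as a function on space. -/
noncomputable def coreTerm (B : E3 →ₗ[ℝ] E3) (a₀ nn : ℝ) (p : E3) : ℝ :=
  (1 - tailW nn (a₀ * ‖B p‖)) * lennardJones (a₀ * ‖B p‖)

/-- `refEnergy − refTail = ½ Σ' (structure-indicator of the core summand)`. [this file] -/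
theorem refEnergy_sub_refTail_eq {θ : ℝ} {c : Chart} (hc : ChartAdmissible θ c) :
    refEnergy c - refTail c = 1 / 2 * ∑' p : E3, (barlowStacking 1 (Real.sqrt (2 / 3)) c.s).indicator (coreTerm c.B c.a₀ c.nn) p := by
  unfold refEnergy refTail
  rw [← mul_sub, ← (hc.2.2.2.2.2.2).tsum_sub (summable_refTail hc), ← tsum_subtype (barlowStacking 1 (Real.sqrt (2 / 3)) c.s) (coreTerm c.B c.a₀ c.nn)]
  congr 1
  exact tsum_congr fun p => by unfold coreTerm; ring

/-- Continuing charts have the same core indicator (points agree on the core ball; the summand vanishes off it). [this file] -/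
theorem indicator_coreTerm_eq_of_continues {θ : ℝ} {c c' : Chart} (hc : ChartAdmissible θ c) (h : Continues θ c c') :
    (barlowStacking 1 (Real.sqrt (2 / 3)) c'.s).indicator (coreTerm c.B c.a₀ c.nn) =
      (barlowStacking 1 (Real.sqrt (2 / 3)) c.s).indicator (coreTerm c.B c.a₀ c.nn) := by
  funext p
  by_cases hp : c.a₀ * ‖c.B p‖ < 44 / 5 * c.nn
  · simp only [Set.indicator_apply, h.2.2.2.2 p hp]
  · have h0 : coreTerm c.B c.a₀ c.nn p = 0 := by
      unfold coreTerm; rw [tailW_eq_one hc.2.2.1 (not_lt.mp hp), sub_self, zero_mul]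
    simp only [Set.indicator_apply, h0, ite_self]

/-- **The reference smooth CORE is continuation-invariant.** [this file] -/
theorem core_eq_of_continues {θ : ℝ} {c c' : Chart} (hc : ChartAdmissible θ c) (h : Continues θ c c') :
    refEnergy c' - refTail c' = refEnergy c - refTail c := by
  rw [refEnergy_sub_refTail_eq h.1, refEnergy_sub_refTail_eq hc, h.2.1, h.2.2.1, h.2.2.2.1,
    indicator_coreTerm_eq_of_continues hc h]

/-- The two reference shells (`‖p‖ ≤ 3/2`) lie in the open core ball of an admissible chart (`θ ≤ 1/5`). [this file] -/
theorem coreBall_of_norm_le {θ : ℝ} {c : Chart} (hc : ChartAdmissible θ c) (hθ : θ ≤ 1 / 5) {p : E3} (hp : ‖p‖ ≤ 3 / 2) :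
    c.a₀ * ‖c.B p‖ < 44 / 5 * c.nn := by
  obtain ⟨hr, ha, -, ⟨Q, hQ⟩, -, ⟨p₁, hp₁, hp₁0, hnn₁⟩, -⟩ := hc
  have h1 : 1 ≤ ‖p₁‖ := one_le_norm_of_mem_barlowStacking hr hp₁ hp₁0
  have hB1 : (1 - 3 * θ) * ‖p₁‖ ≤ ‖c.B p₁‖ := by
    have h' := norm_sub_norm_le (Q p₁) (c.B p₁)
    rw [Q.norm_map, norm_sub_rev] at h'; linarith [hQ p₁]
  have hBp : ‖c.B p‖ ≤ (1 + 3 * θ) * ‖p‖ := by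
    have h' := norm_le_norm_add_norm_sub' (c.B p) (Q p)
    rw [Q.norm_map] at h'; linarith [hQ p]
  have hθ0 : 0 ≤ θ := by
    have h' := (norm_nonneg _).trans (hQ p₁); nlinarith
  have e1 : ‖c.B p‖ ≤ (1 + 3 * θ) * (3 / 2) := hBp.trans (by nlinarith)
  have e2 : 1 - 3 * θ ≤ ‖c.B p₁‖ := le_trans (by nlinarith) hB1
  have hlt : ‖c.B p‖ < 44 / 5 * ‖c.B p₁‖ := by linarith
  rw [hnn₁]; nlinarith [mul_lt_mul_of_pos_left hlt ha]

/-- **`PatternFar` is continuation-invariant** (`θ ≤ 1/5`). [this file] -/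
theorem patternFar_of_continues {θ θ₀ s : ℝ} {c c' : Chart} (hc : ChartAdmissible θ c) (hθ : θ ≤ 1 / 5)
    (h : Continues θ c c') (hP : PatternFar θ₀ s c) : PatternFar θ₀ s c' := by
  obtain ⟨A₀, P, π, hPP, hm, hinj, hfar⟩ := hP
  refine ⟨A₀, P, π, hPP, fun v hv => ?_, hinj, hfar⟩
  obtain ⟨⟨hmem, hne, hnorm⟩, hfit⟩ := hm v hv
  refine ⟨⟨(h.2.2.2.2 (π v) (coreBall_of_norm_le hc hθ hnorm)).mp hmem, hne, hnorm⟩, ?_⟩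
  rw [h.2.1, h.2.2.1, h.2.2.2.1]; exact hfit

/-! ## §3  Z3‴ on the sheltered class, in infimum and in selection form (v7) -/

/-- **Z3‴ · `ShelteredTailTransferInf θ θ₀`** (v7 · NEW · TRUE-type on paper · ATTACKABLE-L; replaces v6's Z3″ `GoodTailTransferInf`, whose `R = 0` instance it
contains): R_aff ⇒ for every exactness constant `C` and every shelter radius `R` there are `C', ε_B` such that for `ε₁ ≤ ε_B` and every window `[δ, 2]` there is
a wall constant `C_T` (depending on `δ`) with: for every injective configuration and every selection of admissible `Cε₁`-exact charts on the SHELTERED normal far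
class `Sh_R`, `Σ_{i ∈ Sh_R} (tailInf θ (F i) − smoothTail G y i) ≤ C_T·#Gᶜ + C'·ε₁·#Sh_R`.
Might fail: a wall-free regular denser good region beating the drift law `exp(cε₁ r/nn)` (module doc). -/
def ShelteredTailTransferInf (θ θ₀ : ℝ) : Prop :=
  AffineChartStraightening →
  ∀ C : ℝ, 0 ≤ C → ∀ R : ℝ, 0 ≤ R → ∃ C' εB : ℝ, 0 ≤ C' ∧ 0 < εB ∧
    ∀ ε₁ : ℝ, 0 < ε₁ → ε₁ ≤ εB → ∀ δ : ℝ, 0 < δ → δ ≤ 2 →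
    ∃ CT : ℝ, 0 ≤ CT ∧ ∀ (N : ℕ) (y : Fin N → E3), Function.Injective y → ∀ F : Fin N → Chart,
      (∀ i ∈ shelteredFarSet R θ₀ 12 ε₁ θ δ y, IsChart C ε₁ y i (F i) ∧ ChartAdmissible θ (F i)) →
        ∑ i ∈ shelteredFarSet R θ₀ 12 ε₁ θ δ y, (tailInf θ (F i) - smoothTail (goodSet 12 ε₁ θ δ y) y i)
          ≤ CT * (((goodSet 12 ε₁ θ δ y)ᶜ).card : ℝ) + C' * ε₁ * ((shelteredFarSet R θ₀ 12 ε₁ θ δ y).card : ℝ)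

/-- **Z3‴ (selection form) · `ShelteredTailTransferSel θ θ₀`**: as `ShelteredTailTransferInf`, but concluding the EXISTENCE of a sitewise continuation `F'`
of the given charts on `Sh_R` with `Σ_{i ∈ Sh_R} (refTail (F' i) − smoothTail G y i) ≤ C_T·#Gᶜ + C'·ε₁·#Sh_R` — what the seam uses. -/
def ShelteredTailTransferSel (θ θ₀ : ℝ) : Prop :=
  AffineChartStraightening →
  ∀ C : ℝ, 0 ≤ C → ∀ R : ℝ, 0 ≤ R → ∃ C' εB : ℝ, 0 ≤ C' ∧ 0 < εB ∧
    ∀ ε₁ : ℝ, 0 < ε₁ → ε₁ ≤ εB → ∀ δ : ℝ, 0 < δ → δ ≤ 2 →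
    ∃ CT : ℝ, 0 ≤ CT ∧ ∀ (N : ℕ) (y : Fin N → E3), Function.Injective y → ∀ F : Fin N → Chart,
      (∀ i ∈ shelteredFarSet R θ₀ 12 ε₁ θ δ y, IsChart C ε₁ y i (F i) ∧ ChartAdmissible θ (F i)) →
        ∃ F' : Fin N → Chart,
          (∀ i ∈ shelteredFarSet R θ₀ 12 ε₁ θ δ y, Continues θ (F i) (F' i)) ∧
          ∑ i ∈ shelteredFarSet R θ₀ 12 ε₁ θ δ y, (refTail (F' i) - smoothTail (goodSet 12 ε₁ θ δ y) y i)
            ≤ CT * (((goodSet 12 ε₁ θ δ y)ᶜ).card : ℝ) + C' * ε₁ * ((shelteredFarSet R θ₀ 12 ε₁ θ δ y).card : ℝ)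

/-- **Infimum form ⇒ selection form** (`C' ↦ C' + 1`, via `ε₁`-minimisers). [this file] -/
theorem shelteredTailTransferSel_of_inf {θ θ₀ : ℝ} (h : ShelteredTailTransferInf θ θ₀) : ShelteredTailTransferSel θ θ₀ := by
  intro hR C hC R hR0
  obtain ⟨C', εB, hC', hεB, hZ⟩ := h hR C hC R hR0
  refine ⟨C' + 1, εB, by linarith, hεB, fun ε₁ hε₁ hε₁B δ hδ hδ2 => ?_⟩
  obtain ⟨CT, hCT, hZ'⟩ := hZ ε₁ hε₁ hε₁B δ hδ hδ2
  refine ⟨CT, hCT, fun N y hy F hF => ?_⟩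
  set G := goodSet 12 ε₁ θ δ y
  set Sh := shelteredFarSet R θ₀ 12 ε₁ θ δ y
  have hch : ∀ i : Fin N, ∃ c' : Chart, i ∈ Sh → Continues θ (F i) c' ∧ refTail c' < tailInf θ (F i) + ε₁ := by
    intro i
    by_cases hi : i ∈ Sh
    · obtain ⟨c', hc', hlt⟩ := exists_continues_lt (hF i hi).2 hε₁
      exact ⟨c', fun _ => ⟨hc', hlt⟩⟩
    · exact ⟨F i, fun h1 => absurd h1 hi⟩
  choose F' hF' using hch
  refine ⟨F', fun i hi => (hF' i hi).1, ?_⟩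
  have hT := hZ' N y hy F hF
  have hle : ∑ i ∈ Sh, (refTail (F' i) - smoothTail G y i) ≤ ∑ i ∈ Sh, ((tailInf θ (F i) - smoothTail G y i) + ε₁) :=
    Finset.sum_le_sum fun i hi => by have h' := (hF' i hi).2; linarith
  rw [Finset.sum_add_distrib, Finset.sum_const, nsmul_eq_mul] at hle
  linarith

/-! ## §4  The seam (v7: sheltered rows charted, unsheltered rows floored and counted) -/

/-- **Column floor into the good class**: for a good site `j`, `Σ_{i ∈ G} V(|y i − y j|) ≥ −1024/(6δ⁶)` — the good class is `δ`-separated from everything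
(`sum_compl_lennardJones_ge` with the class `Gᶜ ∪ {j}`; the diagonal term is `V(0) = 0`). [this file] -/
theorem sum_goodSet_lennardJones_ge {ρ₁ ε₁ θ δ : ℝ} (hδ : 0 < δ) {y : Fin N → E3} (hy : Function.Injective y) {j : Fin N}
    (hj : j ∈ goodSet ρ₁ ε₁ θ δ y) :
    -(1024 / (6 * δ ^ 6)) ≤ ∑ i ∈ goodSet ρ₁ ε₁ θ δ y, lennardJones (dist (y i) (y j)) := by
  have hB : ∀ i : Fin N, i ∉ (goodSet ρ₁ ε₁ θ δ y)ᶜ ∪ {j} → δ ≤ nearestDist y i := fun i hi => by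
    rw [Finset.mem_union, Finset.mem_compl, Finset.mem_singleton, not_or, not_not] at hi
    exact (inWindow_of_mem_goodSet hi.1).1
  have h := sum_compl_lennardJones_ge hδ hy hB (Finset.mem_union_right _ (Finset.mem_singleton_self j))
  have hset : ((goodSet ρ₁ ε₁ θ δ y)ᶜ ∪ {j})ᶜ = (goodSet ρ₁ ε₁ θ δ y).erase j := by
    ext i
    simp only [Finset.mem_compl, Finset.mem_union, Finset.mem_singleton, Finset.mem_erase, not_or, not_not]
    tauto
  rw [hset] at h
  have h0 : lennardJones (dist (y j) (y j)) = 0 := by rw [dist_self]; exact lennardJones_zero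
  rw [← Finset.add_sum_erase _ _ hj, h0, zero_add]
  exact h

/-- **Row floor of a sub-class of the good class: `−(1024/(12δ⁶))·#U ≤ ½·pairSum U G`** (`U ⊆ G`). [this file] -/
theorem half_pairSum_ge_of_subset_goodSet {ρ₁ ε₁ θ δ : ℝ} (hδ : 0 < δ) {y : Fin N → E3} (hy : Function.Injective y)
    {U : Finset (Fin N)} (hU : U ⊆ goodSet ρ₁ ε₁ θ δ y) :
    -(1024 / (12 * δ ^ 6)) * (U.card : ℝ) ≤ 1 / 2 * pairSum U (goodSet ρ₁ ε₁ θ δ y) y := by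
  unfold pairSum
  have hi : ∀ i ∈ U, -(1024 / (6 * δ ^ 6)) ≤ ∑ j ∈ goodSet ρ₁ ε₁ θ δ y, lennardJones (dist (y i) (y j)) := by
    intro i hi
    have h := sum_goodSet_lennardJones_ge hδ hy (hU hi)
    simpa only [dist_comm] using h
  have hsum : (U.card : ℝ) * (-(1024 / (6 * δ ^ 6))) ≤ ∑ i ∈ U, ∑ j ∈ goodSet ρ₁ ε₁ θ δ y, lennardJones (dist (y i) (y j)) := by
    rw [← nsmul_eq_mul, ← Finset.sum_const]
    exact Finset.sum_le_sum hi
  have hδ6 : (1024 : ℝ) / (12 * δ ^ 6) = 1 / 2 * (1024 / (6 * δ ^ 6)) := by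
    field_simp; ring
  rw [hδ6]
  nlinarith [hsum]

/-- **LAYER-5 SEAM (PROVED, v7):
`FarCoreExcess → ShelteredCoreRegistration → ShelteredTailTransferSel → ScaleBadFloor → θ ≤ 1/5 → FarAggregatePricing 12 θ θ₀ κ`.**
The price `c := p` (Z4″'s) and the wall constant `C := C_T + C₄ + (4R/δ + 1)³·(1024/(12δ⁶) + |e⋆ + κ|)` are obtained AFTER `δ`, as `FarAggregatePricing`
permits; the unsheltered normal far rows are floored crudely and counted against `#Gᶜ`. [this file] -/
theorem farAggregatePricing_of_shelteredSeam {θ θ₀ κ : ℝ} (h2 : FarCoreExcess θ θ₀ κ) (hr : ShelteredCoreRegistration θ θ₀)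
    (h3 : ShelteredTailTransferSel θ θ₀) (h4 : ScaleBadFloor θ κ) (hθ : θ ≤ 1 / 5) : FarAggregatePricing 12 θ θ₀ κ := by
  intro hR
  obtain ⟨m, τ, hm, hτ, hZ2⟩ := h2
  obtain ⟨R, C, C₂, εA, hR0, hC, hC₂, hεA, hZr⟩ := hr hR τ hτ
  obtain ⟨C', εB, hC', hεB, hZ3⟩ := h3 hR C hC R hR0
  obtain ⟨p, εC, hp, hεC, hZ4⟩ := h4 hR
  have hden : 0 < C₂ + C' + 1 := by linarith
  refine ⟨min (min εA εB) (min εC (m / (C₂ + C' + 1))),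
    lt_min (lt_min hεA hεB) (lt_min hεC (div_pos hm hden)), fun ε₁ hε₁ hε₁le δ hδ hδ2 => ?_⟩
  have hεA' : ε₁ ≤ εA := hε₁le.trans ((min_le_left _ _).trans (min_le_left _ _))
  have hεB' : ε₁ ≤ εB := hε₁le.trans ((min_le_left _ _).trans (min_le_right _ _))
  have hεC' : ε₁ ≤ εC := hε₁le.trans ((min_le_right _ _).trans (min_le_left _ _))
  have hεm' : (C₂ + C') * ε₁ ≤ m := by
    have h1 := mul_le_mul_of_nonneg_left (hε₁le.trans ((min_le_right _ _).trans (min_le_right _ _))) hden.le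
    rw [mul_div_cancel₀ _ hden.ne'] at h1; nlinarith
  obtain ⟨CT, hCT, hZ3'⟩ := hZ3 ε₁ hε₁ hεB' δ hδ hδ2
  obtain ⟨C4, hC4, hZ4'⟩ := hZ4 ε₁ hε₁ hεC' δ hδ hδ2
  set e : ℝ := ⨅ Q : PeriodicConfiguration 3, Q.energyPerParticle lennardJones
  set K : ℝ := (4 * R / δ + 1) ^ 3 with hK
  set Crow : ℝ := 1024 / (12 * δ ^ 6) with hCrow
  have hK0 : 0 ≤ K := by positivity
  have hCrow0 : 0 ≤ Crow := by positivity
  have hA0 : 0 ≤ |e + κ| := abs_nonneg _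
  refine ⟨p, CT + C4 + K * (Crow + |e + κ|), hp, by positivity, fun N y hy => ?_⟩
  set G := goodSet 12 ε₁ θ δ y
  set Far := farSet θ₀ 12 ε₁ θ δ y
  set sb := goodScaleBadSet 12 ε₁ θ δ y
  set Fn := Far \ sb
  set Sh := shelteredFarSet R θ₀ 12 ε₁ θ δ y
  set Un := Fn \ Sh
  have hsub : sb ⊆ Far := goodScaleBadSet_subset_farSet θ₀ 12 ε₁ θ δ y
  have hShFn : Sh ⊆ Fn := shelteredFarSet_subset R θ₀ 12 ε₁ θ δ y
  have hFarG : Far ⊆ G := farSet_subset_goodSet θ₀ 12 ε₁ θ δ y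
  have hUnG : Un ⊆ G := (Finset.sdiff_subset).trans ((Finset.sdiff_subset).trans hFarG)
  -- charts on the sheltered class
  have hch : ∀ i : Fin N, ∃ c : Chart, i ∈ Sh →
      IsChart C ε₁ y i c ∧ ChartAdmissible θ c ∧ PatternFar θ₀ τ c ∧
        refEnergy c - refTail c - C₂ * ε₁ ≤ smoothCore G y i := by
    intro i
    by_cases hi : i ∈ Sh
    · obtain ⟨c, hc⟩ := hZr ε₁ hε₁ hεA' δ hδ hδ2 N y hy i hi
      exact ⟨c, fun _ => hc⟩
    · exact ⟨⟨fun _ => 0, 0, 1, 1⟩, fun h => absurd h hi⟩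
  choose F hF using hch
  obtain ⟨F', hF', hT⟩ := hZ3' N y hy F fun i hi => let h := hF i hi; ⟨h.1, h.2.1⟩
  -- sheltered rows
  have hrows : ∑ i ∈ Sh, (e + κ + m - C₂ * ε₁ - (refTail (F' i) - smoothTail G y i))
      ≤ ∑ i ∈ Sh, (smoothCore G y i + smoothTail G y i) := by
    refine Finset.sum_le_sum fun i hi => ?_
    have h := hF i hi
    have hc' := hF' i hi
    have hz := hZ2 (F' i) hc'.1 (patternFar_of_continues h.2.1 hθ hc' h.2.2.1)
    have hcore := core_eq_of_continues h.2.1 hc'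
    linarith [h.2.2.2]
  have hconst : ∑ i ∈ Sh, (e + κ + m - C₂ * ε₁ - (refTail (F' i) - smoothTail G y i))
      = (Sh.card : ℝ) * (e + κ + m - C₂ * ε₁) - ∑ i ∈ Sh, (refTail (F' i) - smoothTail G y i) := by
    rw [Finset.sum_sub_distrib, Finset.sum_const, nsmul_eq_mul]
  have hShrows : ∑ i ∈ Sh, (smoothCore G y i + smoothTail G y i) = 1 / 2 * pairSum Sh G y :=
    sum_smoothCore_add_smoothTail Sh G y
  -- unsheltered rows: crude floor and packing count
  have hUnrows : -Crow * (Un.card : ℝ) ≤ 1 / 2 * pairSum Un G y := half_pairSum_ge_of_subset_goodSet hδ hy hUnG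
  have hUn : (Un.card : ℝ) ≤ K * ((Gᶜ.card : ℕ) : ℝ) := card_far_not_sheltered_le hR0 hδ hy
  have hUn1 : Crow * (Un.card : ℝ) ≤ Crow * (K * ((Gᶜ.card : ℕ) : ℝ)) := mul_le_mul_of_nonneg_left hUn hCrow0
  have hUn2 : (Un.card : ℝ) * (e + κ) ≤ |e + κ| * (K * ((Gᶜ.card : ℕ) : ℝ)) := by
    have h1 : (Un.card : ℝ) * (e + κ) ≤ (Un.card : ℝ) * |e + κ| := mul_le_mul_of_nonneg_left (le_abs_self _) (Nat.cast_nonneg _)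
    have h2 : (Un.card : ℝ) * |e + κ| ≤ K * ((Gᶜ.card : ℕ) : ℝ) * |e + κ| := mul_le_mul_of_nonneg_right hUn hA0
    linarith
  -- scale-bad rows
  have h4' := hZ4' N y hy
  -- the decomposition Far = Sh ∪ Un ∪ sb
  have hunion : Fn ∪ sb = Far := Finset.sdiff_union_of_subset hsub
  have hdisj : Disjoint Fn sb := Finset.sdiff_disjoint
  have hunion' : Sh ∪ Un = Fn := Finset.union_sdiff_of_subset hShFn
  have hdisj' : Disjoint Sh Un := Finset.disjoint_sdiff
  have hpair : pairSum Far G y = pairSum Sh G y + pairSum Un G y + pairSum sb G y := by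
    rw [← hunion, pairSum_union_left hdisj G y, ← hunion', pairSum_union_left hdisj' G y]
  have hcard : (Sh.card : ℝ) + (Un.card : ℝ) + (sb.card : ℝ) = (Far.card : ℝ) := by
    have h1 : Fn.card + sb.card = Far.card := Finset.card_sdiff_add_card_eq_card hsub
    have h2 : Un.card + Sh.card = Fn.card := Finset.card_sdiff_add_card_eq_card hShFn
    have h3 : Sh.card + Un.card + sb.card = Far.card := by omega
    exact_mod_cast h3
  have hSh0 : (0 : ℝ) ≤ (Sh.card : ℝ) := Nat.cast_nonneg _
  have hmSh : (C₂ + C') * ε₁ * (Sh.card : ℝ) ≤ m * (Sh.card : ℝ) := mul_le_mul_of_nonneg_right hεm' hSh0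
  show (Far.card : ℝ) * e + κ * (Far.card : ℝ) + p * (sb.card : ℝ) - (CT + C4 + K * (Crow + |e + κ|)) * ((Gᶜ.card : ℕ) : ℝ)
      ≤ 1 / 2 * pairSum Far G y
  rw [hpair, ← hcard]
  nlinarith [hrows, hconst, hShrows, h4', hT, hmSh, hSh0, hUnrows, hUn1, hUn2]

/-- The seam from the INFIMUM form of Z3‴. [this file] -/
theorem farAggregatePricing_of_shelteredSeamInf {θ θ₀ κ : ℝ} (h2 : FarCoreExcess θ θ₀ κ) (hr : ShelteredCoreRegistration θ θ₀)
    (h3 : ShelteredTailTransferInf θ θ₀) (h4 : ScaleBadFloor θ κ) (hθ : θ ≤ 1 / 5) : FarAggregatePricing 12 θ θ₀ κ :=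
  farAggregatePricing_of_shelteredSeam h2 hr (shelteredTailTransferSel_of_inf h3) h4 hθ

/-- **The seam at the literals of record**: Z2, Zr‴, Z3‴ (infimum form), Z4″ at `(θ, θ₀, κ) = (1/25, 1/2000, 1/(2·10⁷))` give
`FarAggregatePricing 12 (1/25) (1/2000) (1/(2·10⁷))`, the Z of the RDEF cone (parametric `tbdsg_of_affineLocalisation`). [this file] -/
theorem farAggregatePricing_record_of_shelteredSeam
    (h2 : FarCoreExcess (1 / 25) (1 / 2000) (1 / (2 * 10 ^ 7))) (hr : ShelteredCoreRegistration (1 / 25) (1 / 2000))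
    (h3 : ShelteredTailTransferInf (1 / 25) (1 / 2000)) (h4 : ScaleBadFloor (1 / 25) (1 / (2 * 10 ^ 7))) :
    FarAggregatePricing 12 (1 / 25) (1 / 2000) (1 / (2 * 10 ^ 7)) :=
  farAggregatePricing_of_shelteredSeamInf h2 hr h3 h4 (by norm_num)

end Summit.AtomisticToContinuum.Crystallization.Theorems.OverbindingBudgetAffineFarSmoothSplit
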